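import Mathlib.Topology.Instances.Matrix
import Literature.Probability.RandomPlanarGeometry.DiskMoebius
import HarnessLib

/-!
# Möbius automorphisms of a round disc as conformal equivalences

Support file for Möbius-averaging arguments on conformally invariant loop ensembles (the
no-touching property of the Camia–Newman scaling limit of critical percolation,
`Literature.Probability.Percolation.TwoArmNoTouchingMoebius`). For `g ∈ SL(2, ℝ)` the disc Möbius
map `diskMoebius g = C ∘ g ∘ C⁻¹` of `DiskMoebius.lean` (`C` the Cayley transform) is shown to be an
automorphism of the closed unit disc, and is rescaled to the disc of radius `ρ`:

* `normSq_num_sub_normSq_den`: `|p w + q|² - |q̄ w + p̄|² = 4 (|w|² - 1)`, whence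
  `‖diskMoebius g w‖ < 1 ↔ ‖w‖ < 1` on the closed disc (`norm_diskMoebius_lt_one`,
  `norm_diskMoebius_eq_one`, `norm_diskMoebius_le_one`), and `diskMoebius g⁻¹` inverts
  `diskMoebius g` (`diskMoebius_inv_apply`, through `cayleyFun_smul`);
* `ballMoebius ρ hρ g : ConformalEquiv (ball 0 ρ) (ball 0 ρ)`, `z ↦ ρ · diskMoebius g (z/ρ)`, and its
  uniformly continuous extension `ballMoebiusExt ρ g : C(ℂ, ℂ)` (through the radial retraction),
  which agrees with it on the open disc, maps the closed disc into itself and everything outside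
  onto the circle of radius `ρ` (`norm_ballMoebiusExt_of_le`), and is jointly continuous in `(g, z)`;
  on the open disc `ballMoebiusExt ρ g z = ρ C (g • C⁻¹(z/ρ))` (`ballMoebiusExt_eq_cayleyFun_smul`);
* `JordanDomain.disc ρ hρ`: the round disc of radius `ρ` as a Jordan domain (carrier `ball 0 ρ`);
* `shearSL θ ∈ SL(2, ℝ)`, `θ ∈ ℂ`: the upper triangular matrices acting on `ℍ` by the affine maps
  `ζ ↦ s ζ + Re θ`, `s = shearScale θ` (`= 1 + Im θ` for `‖θ‖ < 1/2`), a two-parameter family through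
  the identity depending continuously on `θ` (`continuous_shearSL`, `coe_shearSL_smul`), along which
  the orbit `θ ↦ shearSL θ • ζ` of every `ζ ∈ ℍ` is affine in `θ`.

## References

* S. Lang, *SL₂(ℝ)*, GTM 105 (1985), Ch. I §1 (action on `ℍ`, Cayley transform to the disc).
* L. V. Ahlfors, *Complex Analysis*, 3rd ed. (1979), Ch. 3 §3 (automorphisms of the disc).
-/

noncomputable section

open Set Filter Topology Complex Metric
open scoped MatrixGroups Real UpperHalfPlane ComplexConjugate

namespace Literature.Probability.RandomPlanarGeometry

/-! ### The disc Möbius map is an automorphism of the closed unit disc -/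

section DiskMoebius

variable (g : SL(2, ℝ))

/-- The key identity `|p w + q|² - |q̄ w + p̄|² = 4 (|w|² - 1)` for the numerator and denominator of
`diskMoebius g` (Lang, *SL₂(ℝ)*, Ch. I §1). [folklore] -/
theorem normSq_num_sub_normSq_den (w : ℂ) :
    normSq (dmP g * w + dmQ g) - normSq (dmQc g * w + dmPc g) = 4 * (normSq w - 1) := by
  have hdet : g 0 0 * g 1 1 - g 0 1 * g 1 0 = 1 := by
    have := Matrix.SpecialLinearGroup.det_coe g
    rwa [Matrix.det_fin_two] at this
  simp only [dmP, dmQ, dmPc, dmQc, normSq_apply, add_re, add_im, mul_re, mul_im, sub_re, sub_im,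
    ofReal_re, ofReal_im, I_re, I_im]
  linear_combination (4 * (w.re * w.re + w.im * w.im - 1)) * hdet

/-- `1 - |diskMoebius g w|² = 4 (1 - |w|²) / |q̄ w + p̄|²` on the closed unit disc. [folklore] -/
theorem one_sub_normSq_diskMoebius {w : ℂ} (hw : ‖w‖ ≤ 1) :
    1 - normSq (diskMoebius g w) = 4 * (1 - normSq w) / normSq (dmQc g * w + dmPc g) := by
  have hden : normSq (dmQc g * w + dmPc g) ≠ 0 := by
    rw [Ne, normSq_eq_zero]; exact den_ne_zero g hw
  rw [diskMoebius, map_div₀, normSq_neg, eq_div_iff hden, sub_mul, div_mul_cancel₀ _ hden, one_mul]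
  linarith [normSq_num_sub_normSq_den g w]

/-- The disc Möbius map sends the open unit disc into itself. [folklore] -/
theorem norm_diskMoebius_lt_one {w : ℂ} (hw : ‖w‖ < 1) : ‖diskMoebius g w‖ < 1 := by
  have h := one_sub_normSq_diskMoebius g hw.le
  have hden : 0 < normSq (dmQc g * w + dmPc g) := normSq_pos.2 (den_ne_zero g hw.le)
  have hw' : normSq w < 1 := by
    rw [normSq_eq_norm_sq]; nlinarith [norm_nonneg w]
  have hpos : 0 < 1 - normSq (diskMoebius g w) := by rw [h]; positivity
  rw [normSq_eq_norm_sq] at hpos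
  nlinarith [norm_nonneg (diskMoebius g w)]

/-- The disc Möbius map sends the unit circle into itself. [folklore] -/
theorem norm_diskMoebius_eq_one {w : ℂ} (hw : ‖w‖ = 1) : ‖diskMoebius g w‖ = 1 := by
  have h := one_sub_normSq_diskMoebius g hw.le
  rw [normSq_eq_norm_sq w, hw, one_pow, sub_self, mul_zero, zero_div, sub_eq_zero, normSq_eq_norm_sq] at h
  have h' : ‖diskMoebius g w‖ ^ 2 = 1 ^ 2 := by rw [one_pow]; exact h.symm
  exact (sq_eq_sq₀ (norm_nonneg _) zero_le_one).1 h'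

/-- The disc Möbius map sends the closed unit disc into itself. [folklore] -/
theorem norm_diskMoebius_le_one {w : ℂ} (hw : ‖w‖ ≤ 1) : ‖diskMoebius g w‖ ≤ 1 := by
  rcases hw.lt_or_eq with h | h
  · exact (norm_diskMoebius_lt_one g h).le
  · exact (norm_diskMoebius_eq_one g h).le

/-- On the open disc, `diskMoebius g w = C (g • C⁻¹ w)`. [folklore] -/
theorem diskMoebius_eq_cayleyFun_smul {w : ℂ} (hw : ‖w‖ < 1) :
    diskMoebius g w = cayleyFun ((g • ofDisc w hw : ℍ) : ℂ) := by
  rw [cayleyFun_smul, cayleyFun_ofDisc]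

/-- `diskMoebius g⁻¹` undoes `diskMoebius g` on the open disc. [folklore] -/
theorem diskMoebius_inv_apply {w : ℂ} (hw : ‖w‖ < 1) : diskMoebius g⁻¹ (diskMoebius g w) = w := by
  rw [diskMoebius_eq_cayleyFun_smul g hw, ← cayleyFun_smul, inv_smul_smul, cayleyFun_ofDisc]

/-- The disc Möbius map is holomorphic on the open unit disc. [folklore] -/
theorem differentiableOn_diskMoebius : DifferentiableOn ℂ (diskMoebius g) (ball 0 1) := by
  have h : diskMoebius g = fun w ↦ -(dmP g * w + dmQ g) / (dmQc g * w + dmPc g) := rfl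
  rw [h]
  exact DifferentiableOn.div (by fun_prop) (by fun_prop) fun w hw ↦ den_ne_zero g (mem_ball_zero_iff.1 hw).le

/-- The extension `diskMoebiusExt` is jointly continuous in `(g, z)` on `SL(2, ℝ) × ℂ`. [folklore] -/
theorem continuous_diskMoebiusExt_uncurry : Continuous fun p : SL(2, ℝ) × ℂ ↦ diskMoebiusExt p.1 p.2 := by
  have h1 : Continuous fun p : SL(2, ℝ) × ℂ ↦ (p.1, radialRetr p.2) := by fun_prop
  have h2 : MapsTo (fun p : SL(2, ℝ) × ℂ ↦ (p.1, radialRetr p.2)) univ (univ ×ˢ closedBall 0 1) :=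
    fun p _ ↦ ⟨mem_univ _, radialRetr_mem_closedBall p.2⟩
  have := continuousOn_diskMoebius_uncurry.comp_continuous h1 (fun p ↦ h2 (mem_univ p))
  simp only [diskMoebiusExt_apply]
  exact this

end DiskMoebius

/-! ### The rescaled automorphisms of the disc of radius `ρ` -/

section Ball

variable (ρ : ℝ) (g : SL(2, ℝ))

/-- **The Möbius automorphism `z ↦ ρ · diskMoebius g (z/ρ)` of the disc of radius `ρ > 0`**, as a
conformal equivalence `ball 0 ρ → ball 0 ρ` with inverse the automorphism of `g⁻¹`
(Ahlfors 1979, Ch. 3 §3). [folklore] -/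
def ballMoebius (hρ : 0 < ρ) : ConformalEquiv (ball (0 : ℂ) ρ) (ball (0 : ℂ) ρ) where
  toFun z := (ρ : ℂ) * diskMoebius g (z / ρ)
  invFun z := (ρ : ℂ) * diskMoebius g⁻¹ (z / ρ)
  source := ball 0 ρ
  target := ball 0 ρ
  map_source' z hz := by
    have hz' : ‖z / (ρ : ℂ)‖ < 1 := by
      rw [norm_div, Complex.norm_real, Real.norm_eq_abs, abs_of_pos hρ, div_lt_one hρ]; exact mem_ball_zero_iff.1 hz
    rw [mem_ball_zero_iff, norm_mul, Complex.norm_real, Real.norm_eq_abs, abs_of_pos hρ]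
    calc ρ * ‖diskMoebius g (z / ρ)‖ < ρ * 1 := mul_lt_mul_of_pos_left (norm_diskMoebius_lt_one g hz') hρ
      _ = ρ := mul_one ρ
  map_target' z hz := by
    have hz' : ‖z / (ρ : ℂ)‖ < 1 := by
      rw [norm_div, Complex.norm_real, Real.norm_eq_abs, abs_of_pos hρ, div_lt_one hρ]; exact mem_ball_zero_iff.1 hz
    rw [mem_ball_zero_iff, norm_mul, Complex.norm_real, Real.norm_eq_abs, abs_of_pos hρ]
    calc ρ * ‖diskMoebius g⁻¹ (z / ρ)‖ < ρ * 1 := mul_lt_mul_of_pos_left (norm_diskMoebius_lt_one g⁻¹ hz') hρ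
      _ = ρ := mul_one ρ
  left_inv' z hz := by
    have hρ' : (ρ : ℂ) ≠ 0 := by exact_mod_cast hρ.ne'
    have hz' : ‖z / (ρ : ℂ)‖ < 1 := by
      rw [norm_div, Complex.norm_real, Real.norm_eq_abs, abs_of_pos hρ, div_lt_one hρ]; exact mem_ball_zero_iff.1 hz
    show (ρ : ℂ) * diskMoebius g⁻¹ ((ρ : ℂ) * diskMoebius g (z / ρ) / ρ) = z
    rw [mul_div_cancel_left₀ _ hρ', diskMoebius_inv_apply g hz', mul_div_cancel₀ _ hρ']
  right_inv' z hz := by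
    have hρ' : (ρ : ℂ) ≠ 0 := by exact_mod_cast hρ.ne'
    have hz' : ‖z / (ρ : ℂ)‖ < 1 := by
      rw [norm_div, Complex.norm_real, Real.norm_eq_abs, abs_of_pos hρ, div_lt_one hρ]; exact mem_ball_zero_iff.1 hz
    show (ρ : ℂ) * diskMoebius g ((ρ : ℂ) * diskMoebius g⁻¹ (z / ρ) / ρ) = z
    have h := diskMoebius_inv_apply g⁻¹ hz'
    rw [inv_inv] at h
    rw [mul_div_cancel_left₀ _ hρ', h, mul_div_cancel₀ _ hρ']
  source_eq := rfl
  target_eq := rfl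
  differentiableOn := by
    have hmaps : MapsTo (fun z : ℂ ↦ z / ρ) (ball (0 : ℂ) ρ) (ball 0 1) := by
      intro z hz
      rw [mem_ball_zero_iff, norm_div, Complex.norm_real, Real.norm_eq_abs, abs_of_pos hρ, div_lt_one hρ]
      exact mem_ball_zero_iff.1 hz
    exact ((differentiableOn_diskMoebius g).comp (by fun_prop) hmaps).const_mul _
  differentiableOn_symm := by
    have hmaps : MapsTo (fun z : ℂ ↦ z / ρ) (ball (0 : ℂ) ρ) (ball 0 1) := by
      intro z hz
      rw [mem_ball_zero_iff, norm_div, Complex.norm_real, Real.norm_eq_abs, abs_of_pos hρ, div_lt_one hρ]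
      exact mem_ball_zero_iff.1 hz
    exact ((differentiableOn_diskMoebius g⁻¹).comp (by fun_prop) hmaps).const_mul _

/-- `ballMoebius ρ hρ g` acts as `z ↦ ρ · diskMoebius g (z/ρ)`. [folklore] -/
@[simp] theorem ballMoebius_apply (hρ : 0 < ρ) (z : ℂ) : ballMoebius ρ g hρ z = (ρ : ℂ) * diskMoebius g (z / ρ) := rfl

/-- **The extension of the Möbius automorphism of the disc of radius `ρ` to `ℂ`** by the radial
retraction: `z ↦ ρ · diskMoebiusExt g (z/ρ)`, a continuous map of the plane. [folklore] -/
def ballMoebiusExt : C(ℂ, ℂ) :=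
  ⟨fun z ↦ (ρ : ℂ) * diskMoebiusExt g (z / ρ), by fun_prop⟩

/-- Unfolding `ballMoebiusExt`. [folklore] -/
@[simp] theorem ballMoebiusExt_apply (z : ℂ) : ballMoebiusExt ρ g z = (ρ : ℂ) * diskMoebius g (radialRetr (z / ρ)) := rfl

variable {ρ}

/-- Norm of `z / ρ`. [folklore] -/
theorem norm_div_ofReal (hρ : 0 < ρ) (z : ℂ) : ‖z / (ρ : ℂ)‖ = ‖z‖ / ρ := by
  rw [norm_div, Complex.norm_real, Real.norm_eq_abs, abs_of_pos hρ]

/-- On the closed disc of radius `ρ` the extension is the Möbius formula. [folklore] -/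
theorem ballMoebiusExt_of_norm_le (hρ : 0 < ρ) {z : ℂ} (hz : ‖z‖ ≤ ρ) :
    ballMoebiusExt ρ g z = (ρ : ℂ) * diskMoebius g (z / ρ) := by
  rw [ballMoebiusExt_apply, radialRetr_of_norm_le_one]
  rwa [norm_div_ofReal hρ, div_le_one hρ]

/-- On the open disc of radius `ρ` the extension agrees with the conformal automorphism. [folklore] -/
theorem eqOn_ballMoebiusExt (hρ : 0 < ρ) : EqOn (ballMoebiusExt ρ g) (ballMoebius ρ g hρ) (ball 0 ρ) :=
  fun _ hz ↦ ballMoebiusExt_of_norm_le g hρ (mem_ball_zero_iff.1 hz).le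

/-- The extension takes values in the closed disc of radius `ρ`. [folklore] -/
theorem norm_ballMoebiusExt_le (hρ : 0 < ρ) (z : ℂ) : ‖ballMoebiusExt ρ g z‖ ≤ ρ := by
  rw [ballMoebiusExt_apply, norm_mul, Complex.norm_real, Real.norm_eq_abs, abs_of_pos hρ]
  calc ρ * ‖diskMoebius g (radialRetr (z / ρ))‖ ≤ ρ * 1 :=
        mul_le_mul_of_nonneg_left (norm_diskMoebius_le_one g (norm_radialRetr_le_one _)) hρ.le
    _ = ρ := mul_one ρ

/-- The extension maps the closed disc (the closure of the open disc) into itself. [folklore] -/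
theorem mapsTo_ballMoebiusExt_closure (hρ : 0 < ρ) :
    MapsTo (ballMoebiusExt ρ g) (closure (ball (0 : ℂ) ρ)) (closure (ball (0 : ℂ) ρ)) := by
  intro z _
  rw [closure_ball _ hρ.ne', mem_closedBall_zero_iff]
  exact norm_ballMoebiusExt_le g hρ z

/-- Points at distance `≥ ρ` from the origin are sent to the circle of radius `ρ`. [folklore] -/
theorem norm_ballMoebiusExt_of_le (hρ : 0 < ρ) {z : ℂ} (hz : ρ ≤ ‖z‖) : ‖ballMoebiusExt ρ g z‖ = ρ := by
  have h1 : 1 ≤ ‖z / (ρ : ℂ)‖ := by rwa [norm_div_ofReal hρ, le_div_iff₀ hρ, one_mul]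
  have h2 : ‖radialRetr (z / ρ)‖ = 1 := by
    rw [norm_radialRetr, max_eq_right h1, div_self (by linarith)]
  rw [ballMoebiusExt_apply, norm_mul, Complex.norm_real, Real.norm_eq_abs, abs_of_pos hρ,
    norm_diskMoebius_eq_one g h2, mul_one]

/-- In the open disc of radius `ρ` a point `z` corresponds to the point `C⁻¹(z/ρ)` of `ℍ`. [folklore] -/
theorem norm_div_lt_one (hρ : 0 < ρ) {z : ℂ} (hz : ‖z‖ < ρ) : ‖z / (ρ : ℂ)‖ < 1 := by
  rwa [norm_div_ofReal hρ, div_lt_one hρ]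

/-- **The Cayley formula**: on the open disc, `ballMoebiusExt ρ g z = ρ · C (g • C⁻¹(z/ρ))`. [folklore] -/
theorem ballMoebiusExt_eq_cayleyFun_smul (hρ : 0 < ρ) {z : ℂ} (hz : ‖z‖ < ρ) :
    ballMoebiusExt ρ g z = (ρ : ℂ) * cayleyFun ((g • ofDisc (z / ρ) (norm_div_lt_one hρ hz) : ℍ) : ℂ) := by
  rw [ballMoebiusExt_of_norm_le g hρ hz.le, diskMoebius_eq_cayleyFun_smul]

variable (ρ)

/-- The extension is uniformly continuous. [folklore] -/
theorem uniformContinuous_ballMoebiusExt : UniformContinuous (ballMoebiusExt ρ g) := by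
  have h1 : UniformContinuous fun z : ℂ ↦ z / (ρ : ℂ) := by
    rw [show (fun z : ℂ ↦ z / (ρ : ℂ)) = fun z ↦ (ρ : ℂ)⁻¹ • z from
      funext fun z ↦ by rw [smul_eq_mul, div_eq_inv_mul]]
    exact (lipschitzWith_smul (ρ : ℂ)⁻¹).uniformContinuous
  have h2 : UniformContinuous fun z : ℂ ↦ (ρ : ℂ) * z := by
    rw [show (fun z : ℂ ↦ (ρ : ℂ) * z) = fun z ↦ (ρ : ℂ) • z from funext fun z ↦ by rw [smul_eq_mul]]
    exact (lipschitzWith_smul (ρ : ℂ)).uniformContinuous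
  exact h2.comp ((uniformContinuous_diskMoebiusExt g).comp h1)

/-- The extension is jointly continuous in `(g, z)`. [folklore] -/
theorem continuous_ballMoebiusExt_uncurry : Continuous fun p : SL(2, ℝ) × ℂ ↦ ballMoebiusExt ρ p.1 p.2 := by
  have h1 : Continuous fun p : SL(2, ℝ) × ℂ ↦ (p.1, p.2 / (ρ : ℂ)) := by fun_prop
  have h2 := continuous_diskMoebiusExt_uncurry.comp h1
  exact continuous_const.mul h2

end Ball

/-! ### The round disc of radius `ρ` as a Jordan domain -/

namespace JordanDomain

/-- The open **disc of radius `ρ > 0`** centred at the origin as a Jordan domain, with boundary the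
circle of radius `ρ` parametrised by `t ↦ ρ exp (2πit)` (as `JordanDomain.unitDisc`). [folklore] -/
def disc (ρ : ℝ) (hρ : 0 < ρ) : JordanDomain where
  carrier := Metric.ball 0 ρ
  boundary t := circleMap 0 ρ (2 * π * t)
  isOpen := Metric.isOpen_ball
  isBounded := Metric.isBounded_ball
  isConnected := ((convex_ball (0 : ℂ) ρ).isPathConnected (by simp [hρ])).isConnected
  continuous_boundary := (continuous_circleMap 0 ρ).comp (continuous_const.mul continuous_id)
  periodic_boundary t := by
    simp only
    rw [mul_add, mul_one]
    exact periodic_circleMap 0 ρ _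
  injOn_boundary := by
    intro s hs t ht h
    have hinj := injOn_circleMap_of_abs_sub_le' (c := 0) (a := 0) (b := 2 * π) hρ.ne' (by simp)
    have key : 2 * π * s = 2 * π * t :=
      hinj ⟨by nlinarith [Real.pi_pos, hs.1], by nlinarith [Real.pi_pos, hs.2]⟩
        ⟨by nlinarith [Real.pi_pos, ht.1], by nlinarith [Real.pi_pos, ht.2]⟩ h
    exact mul_left_cancel₀ (by positivity) key
  range_boundary := by
    have hs : Function.Surjective fun t : ℝ ↦ 2 * π * t := fun y ↦
      ⟨y / (2 * π), by field_simp⟩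
    rw [frontier_ball _ hρ.ne', show (fun t : ℝ ↦ circleMap 0 ρ (2 * π * t)) =
      circleMap 0 ρ ∘ fun t : ℝ ↦ 2 * π * t from rfl, hs.range_comp, range_circleMap, abs_of_pos hρ]

/-- The carrier of the disc Jordan domain is the open ball (by definition). [folklore] -/
@[simp] theorem carrier_disc (ρ : ℝ) (hρ : 0 < ρ) : (disc ρ hρ).carrier = Metric.ball 0 ρ := rfl

/-- The closure of the disc Jordan domain is the closed ball. [folklore] -/
theorem closure_carrier_disc (ρ : ℝ) (hρ : 0 < ρ) : closure (disc ρ hρ).carrier = Metric.closedBall 0 ρ := by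
  rw [carrier_disc, closure_ball _ hρ.ne']

end JordanDomain

/-! ### A two-parameter family of shears of `ℍ` through the identity -/

section Shear

/-- The dilation factor `max (1 + Im θ) (1/2)` of the shear `shearSL θ` (equal to `1 + Im θ` for
`‖θ‖ < 1/2`; truncated below so that it is always positive). [folklore] -/
def shearScale (θ : ℂ) : ℝ := max (1 + θ.im) 2⁻¹

/-- The dilation factor is positive. [folklore] -/
theorem shearScale_pos (θ : ℂ) : 0 < shearScale θ := lt_max_of_lt_right (by norm_num)

/-- For `‖θ‖ < 1/2` the dilation factor is `1 + Im θ`. [folklore] -/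
theorem shearScale_eq {θ : ℂ} (h : ‖θ‖ < 2⁻¹) : shearScale θ = 1 + θ.im := by
  have := Complex.abs_im_le_norm θ
  rw [shearScale, max_eq_left]
  have := neg_abs_le θ.im
  linarith

/-- The dilation factor depends continuously on `θ`. [folklore] -/
@[fun_prop] theorem continuous_shearScale : Continuous shearScale := by
  unfold shearScale; fun_prop

/-- **The shear `ζ ↦ s ζ + Re θ` of `ℍ` as an element of `SL(2, ℝ)`**: the upper triangular matrix
`(√s, Re θ/√s; 0, 1/√s)`, `s = shearScale θ` (Lang, *SL₂(ℝ)*, Ch. I §1: the affine group inside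
`SL(2, ℝ)`). [folklore] -/
def shearSL (θ : ℂ) : SL(2, ℝ) :=
  ⟨!![Real.sqrt (shearScale θ), θ.re / Real.sqrt (shearScale θ); 0, (Real.sqrt (shearScale θ))⁻¹], by
    have h : Real.sqrt (shearScale θ) ≠ 0 := (Real.sqrt_pos.2 (shearScale_pos θ)).ne'
    rw [Matrix.det_fin_two_of]
    field_simp
    ring⟩

/-- The entries of `shearSL θ`. [folklore] -/
@[simp] theorem shearSL_apply_zero_zero (θ : ℂ) : (shearSL θ) 0 0 = Real.sqrt (shearScale θ) := rfl

/-- The entries of `shearSL θ`. [folklore] -/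
@[simp] theorem shearSL_apply_zero_one (θ : ℂ) : (shearSL θ) 0 1 = θ.re / Real.sqrt (shearScale θ) := rfl

/-- The entries of `shearSL θ`. [folklore] -/
@[simp] theorem shearSL_apply_one_zero (θ : ℂ) : (shearSL θ) 1 0 = 0 := rfl

/-- The entries of `shearSL θ`. [folklore] -/
@[simp] theorem shearSL_apply_one_one (θ : ℂ) : (shearSL θ) 1 1 = (Real.sqrt (shearScale θ))⁻¹ := rfl

/-- The shear depends continuously on `θ`. [folklore] -/
theorem continuous_shearSL : Continuous shearSL := by
  refine Continuous.subtype_mk (continuous_matrix fun i j ↦ ?_) _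
  have hs : Continuous fun θ : ℂ ↦ Real.sqrt (shearScale θ) := by fun_prop
  have hne : ∀ θ : ℂ, Real.sqrt (shearScale θ) ≠ 0 := fun θ ↦ (Real.sqrt_pos.2 (shearScale_pos θ)).ne'
  fin_cases i <;> fin_cases j
  · simpa using hs
  · simpa using Complex.continuous_re.div₀ hs hne
  · simpa using continuous_const
  · exact continuous_iff_continuousAt.2 fun x ↦ (hs.tendsto x).inv₀ (hne x)

/-- **The shear acts on `ℍ` by the affine map `ζ ↦ s ζ + Re θ`**, `s = shearScale θ`. [folklore] -/
theorem coe_shearSL_smul (θ : ℂ) (ζ : ℍ) :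
    ((shearSL θ • ζ : ℍ) : ℂ) = (shearScale θ : ℂ) * ζ + θ.re := by
  have hs : 0 < Real.sqrt (shearScale θ) := Real.sqrt_pos.2 (shearScale_pos θ)
  have hs' : ((Real.sqrt (shearScale θ) : ℝ) : ℂ) ≠ 0 := by exact_mod_cast hs.ne'
  have hsq : ((Real.sqrt (shearScale θ) : ℝ) : ℂ) * (Real.sqrt (shearScale θ) : ℝ) = (shearScale θ : ℂ) := by
    rw [← ofReal_mul, Real.mul_self_sqrt (shearScale_pos θ).le]
  rw [UpperHalfPlane.coe_specialLinearGroup_apply]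
  simp only [Algebra.algebraMap_self_apply, shearSL_apply_zero_zero, shearSL_apply_zero_one, shearSL_apply_one_zero,
    shearSL_apply_one_one, ofReal_div, ofReal_zero, zero_mul, zero_add, ofReal_inv]
  rw [div_inv_eq_mul, add_mul, div_mul_cancel₀ _ hs', mul_right_comm, hsq]

/-- For `‖θ‖ < 1/2` the shear acts by `ζ ↦ (1 + Im θ) ζ + Re θ = ζ + (Re θ + Im θ · ζ)`, affinely in
`θ`. [folklore] -/
theorem coe_shearSL_smul_of_norm_lt {θ : ℂ} (h : ‖θ‖ < 2⁻¹) (ζ : ℍ) :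
    ((shearSL θ • ζ : ℍ) : ℂ) = (ζ : ℂ) + ((θ.re : ℂ) + (θ.im : ℂ) * ζ) := by
  rw [coe_shearSL_smul, shearScale_eq h]
  push_cast
  ring

end Shear

end Literature.Probability.RandomPlanarGeometry
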